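import Literature.MathematicalPhysics.QuantumLattice.EmeryThreeBandByDecoration
import HarnessLib

/-!
# One-sided (Hellmann–Feynman) coupling directions of superlattice view families: monotonicity of the
# variational cell energy, one-sided Lipschitz transport, box ⇒ word with upward extension — and the
# three-band (Emery) instance: `U_d`, `U_p`, `ε_d`, `ε_p` are one-sided

Topic `Literature/MathematicalPhysics/QuantumLattice` (family `hubbard`; general dimension `d`). Sequel of
`SuperlatticeCellEnergyFamilies` (§4: the coupling-family calculus of `infCellEnergyOn S (viewFamily M₀ D θ) R` —
joint concavity, box ⇒ word from the `2^|ι|` vertices, the two-sided Lipschitz bound `Σ_a C_a|Δθ_a|`, trial and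
tangent caps), `SublatticeSelectiveInteractions` (§5: the sublattice on-site atoms `sublatticeOnSite q c ε U`,
`e_Φ(ω) = [0 ∈ coset]·(ε ρ(ω) + U D(ω))`) and `EmeryThreeBandByDecoration` (the decorated `CuO₂` model, its
fourteen coupling directions `emeryDirections`, `emeryEnergyDensity θ ρ`). Written for the box → word seam of the
Hubbard material-oracle programme (stage S1/S2: a parameter BOX must map to a certified WORD): the calculus of the
prequels treats every coupling direction as two-sided, so a floor costs `C_a|Δθ_a|` whichever way the coupling
moves and a box floor needs all `2^|ι|` vertices. For a direction whose CONJUGATE DENSITY IS NON-NEGATIVE ON THE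
CLASS (an on-site repulsion: `D(ω) = Re ω(n_↑n_↓) ≥ 0`; a site energy: `ρ(ω) ≥ 0`) the dependence is MONOTONE
(Hellmann–Feynman sign): floors move UP the coupling for free, caps move DOWN for free, the Lipschitz price is
paid only in the adverse sense, and a floor certified at the vertices of a box holds on the whole upper orthant
above the box in those directions (equivalently: only the LOWER face in those directions needs vertices). This is
the superlattice / multi-band twin of the one-band facts `energyDensityTT'_anchor_le` (monotone in `U`) and the
`V ≥ 0` transport of `HubbardTTPrimeNNRepulsionTransport`.

* §1 generic, any class `S`, any view family: `InfVolFermionState.cellEnergy_viewFamily_mono` (pointwise),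
  `infCellEnergyOn_viewFamily_mono`, floor-up / cap-down corollaries, the ONE-SIDED LIPSCHITZ bound
  `infCellEnergyOn_viewFamily_sub_le_oneSided` (positive directions enter with `max (θ_a − θ'_a) 0` instead of
  `|θ_a − θ'_a|`) with its floor / cap readings, and BOX ⇒ WORD WITH UPWARD EXTENSION
  `le_infCellEnergyOn_viewFamily_of_vertices_of_le`.
* §2 the sign: `Re ω(n_{xσ} n_{yτ}) ≥ 0`, `e_{sublatticeOnSite q c ε U}(ω) ≥ 0` and the cell energy of its views
  `≥ 0` for `ε, U ≥ 0`, every state (no class restriction).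
* §3 the three-band (Emery) instance: directions `8–13` (`ε_d`, `ε_{p_x}`, `ε_{p_y}`, `U_d`, `U_{p_x}`, `U_{p_y}`)
  have non-negative cell energy in every state ⇒ `emeryEnergyDensity_mono` (θ-level), `emeryEnergyDensity_line_mono`
  (physical parameters `(t_pd, t_pp, ε_d, ε_p, U_d, U_p)`: monotone in the last four at fixed hoppings),
  `emeryEnergyDensity_sub_le_oneSided` (bond classes `2|Δ|`, site energies `2·Δ⁺`, repulsions `1·Δ⁺`), and
  `le_emeryEnergyDensity_of_vertices_of_le` (a floor at the vertices of a coupling box holds at every coupling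
  vector above the box's lower corner whose eight bond amplitudes stay inside the box).

Everything is PROVED; no definition, no named fact, no number of record, no `sorry`. HONEST SCOPE: variational
(class-infimum) energy words only; the sign hypothesis is per direction and per class (it is discharged here for
sublattice on-site atoms with non-negative coefficients, in every state); hopping directions are genuinely
two-sided (no sign) and keep their `|Δ|` price; nothing here certifies a number about a material, and no producer
(certificate format) exists yet for the three-band object — these are the transport rules such words will obey.

## Mathlib / tree search

REUSED: `viewFamily`, `InfVolFermionState.cellEnergy_viewFamily_eq_add_sum_sub_mul`, `infCellEnergyOn`,
`infCellEnergyOn_empty`, `le_infCellEnergyOn`, `infCellEnergyOn_le_cellEnergy`,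
`le_infCellEnergyOn_viewFamily_of_mem_Icc` (`SuperlatticeCellEnergyFamilies`); `sublatticeOnSite`,
`sublatticeOnSiteViews`, `InfVolFermionState.meanEnergy_sublatticeOnSite` (`SublatticeSelectiveInteractions`);
`emeryDirections`, `emeryConstants`, `abs_cellEnergy_emeryDirections_le`, `emeryViews`, `emeryLine`, `emeryStates`,
`emeryEnergyDensity` (`EmeryThreeBandByDecoration`); `InfVolFermionState.density_nonneg`,
`re_expect_nonneg_of_isHermitian_of_isIdempotentElem`, `isHermitian_isIdempotentElem_mul_of_commute`
(`HubbardEnergyDensityChemicalPotential`); `numberAt_commute`, `numberAt_isHermitian`, `numberAt_idempotent`.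
`lean search 'infCellEnergyOn.*mono|emeryEnergyDensity_(mono|le_of)|cellEnergy.*nonneg|oneSided' --decl`: nothing in
`QuantumLattice` (the one-band monotonicity-in-`U` facts live on `energyDensityTT'`, not on view families).

## References

* R. P. Feynman, Phys. Rev. 56 (1939) 340 (the Hellmann–Feynman sign: `∂E/∂λ = ⟨∂H/∂λ⟩`; here in its
  variational, derivative-free form) — cited through Israel's convexity framework. [cite: Israel1979, Thm. I.3.4]
* R. B. Griffiths, J. Math. Phys. 5 (1964) 1215; Phys. Rev. 152 (1966) 240, §II (monotonicity / convexity of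
  ground-state energies in a coupling). [cite: Griffiths1966, §II]
* O. Bratteli, D. W. Robinson, *OAQSM 1* (1987), §2.3.2 (states are positive: `ω(P) ≥ 0` on projections).
  [cite: BratteliRobinsonI1987, §2.3.2]
* R. T. Rockafellar, *Convex Analysis* (1970), Thm. 32.2 (extrema of concave functions over polytopes).
  [cite: Rockafellar1970, Thm 32.2]
* V. J. Emery, PRL 58 (1987) 2794, via E. Pavarini et al., PRL 87 (2001) 047003, eq. (1). [cite: PavariniEtAl2001, eq. (1)]
-/

noncomputable section

namespace Literature.MathematicalPhysics.QuantumLattice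

open Matrix Finset HubbardWave0 Literature.Probability.LatticeModels ThermodynamicLimit
open Literature.Computation.Certificates
open scoped ComplexOrder BigOperators

/-! ### §1. One-sided directions of a view family over any class -/

section OneSided

variable {d : ℕ} {q : Fin d → ℕ} {ι : Type*} [Fintype ι] {S : Set (InfVolFermionState d)}
  (M₀ : Cell q → FermionInteraction d) (D : ι → Cell q → FermionInteraction d) (R : ℝ)

/-- **Hellmann–Feynman sign, pointwise**: if `θ ≤ θ'` coordinatewise and every direction that actually moves has
non-negative cell energy in the state `ω`, then `e_{M(θ)}(ω) ≤ e_{M(θ')}(ω)` (the cell energy is affine in `θ`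
with slopes `e_{D_a}(ω)`). [cite: Israel1979, Thm. I.3.4] -/
theorem InfVolFermionState.cellEnergy_viewFamily_mono (ω : InfVolFermionState d) {θ θ' : ι → ℝ} (hle : θ ≤ θ')
    (hpos : ∀ a, θ a < θ' a → 0 ≤ ω.cellEnergy (D a) R) :
    ω.cellEnergy (viewFamily M₀ D θ) R ≤ ω.cellEnergy (viewFamily M₀ D θ') R := by
  rw [ω.cellEnergy_viewFamily_eq_add_sum_sub_mul M₀ D θ' θ R]
  refine le_add_of_nonneg_right (Finset.sum_nonneg fun a _ => ?_)
  rcases (hle a).lt_or_eq with h | h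
  · exact mul_nonneg (sub_nonneg.2 h.le) (hpos a h)
  · rw [h, sub_self, zero_mul]

/-- **MONOTONICITY of the variational cell energy in one-sided directions**: `θ ≤ θ'`, and every moving direction
has non-negative cell energy ON THE CLASS `S`, give `e_S(θ) ≤ e_S(θ')` (an infimum of monotone affine functions).
[cite: Griffiths1966, §II] -/
theorem infCellEnergyOn_viewFamily_mono {θ θ' : ι → ℝ} (hle : θ ≤ θ')
    (hpos : ∀ a, θ a < θ' a → ∀ ω ∈ S, 0 ≤ ω.cellEnergy (D a) R) :
    infCellEnergyOn S (viewFamily M₀ D θ) R ≤ infCellEnergyOn S (viewFamily M₀ D θ') R := by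
  rcases S.eq_empty_or_nonempty with rfl | hS
  · simp only [infCellEnergyOn_empty, le_refl]
  exact le_infCellEnergyOn _ R hS fun ω hω =>
    (infCellEnergyOn_le_cellEnergy _ R hω).trans
      (ω.cellEnergy_viewFamily_mono M₀ D R hle fun a ha => hpos a ha ω hω)

/-- **Floors move UP a one-sided direction for free**: a floor `m ≤ e_S(θ)` at the anchor holds at every `θ' ≥ θ`
that differs from `θ` only in directions with non-negative conjugate density on `S`. [cite: Griffiths1966, §II] -/
theorem le_infCellEnergyOn_viewFamily_of_le_of_mono {m : ℝ} {θ θ' : ι → ℝ}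
    (hm : m ≤ infCellEnergyOn S (viewFamily M₀ D θ) R) (hle : θ ≤ θ')
    (hpos : ∀ a, θ a < θ' a → ∀ ω ∈ S, 0 ≤ ω.cellEnergy (D a) R) :
    m ≤ infCellEnergyOn S (viewFamily M₀ D θ') R :=
  hm.trans (infCellEnergyOn_viewFamily_mono M₀ D R hle hpos)

/-- **Caps move DOWN a one-sided direction for free**: a cap `e_S(θ') ≤ c` at the anchor holds at every `θ ≤ θ'`
that differs from `θ'` only in directions with non-negative conjugate density on `S`. [cite: Griffiths1966, §II] -/
theorem infCellEnergyOn_viewFamily_le_of_le_of_mono {c : ℝ} {θ θ' : ι → ℝ}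
    (hc : infCellEnergyOn S (viewFamily M₀ D θ') R ≤ c) (hle : θ ≤ θ')
    (hpos : ∀ a, θ a < θ' a → ∀ ω ∈ S, 0 ≤ ω.cellEnergy (D a) R) :
    infCellEnergyOn S (viewFamily M₀ D θ) R ≤ c :=
  (infCellEnergyOn_viewFamily_mono M₀ D R hle hpos).trans hc

/-- **ONE-SIDED LIPSCHITZ BOUND** (non-empty class, class constants `|e_{D_a}(ω)| ≤ C_a` on `S`, a set `P` of
directions with `e_{D_a}(ω) ≥ 0` on `S`): `e_S(θ) − e_S(θ') ≤ Σ_a C_a·δ_a` with `δ_a = max (θ_a − θ'_a) 0` for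
`a ∈ P` and `δ_a = |θ_a − θ'_a|` otherwise — along a positive direction only the amount by which `θ` lies ABOVE
`θ'` is paid. [cite: Israel1979, Thm. I.3.4] -/
theorem infCellEnergyOn_viewFamily_sub_le_oneSided (hS : S.Nonempty) {C : ι → ℝ}
    (hC : ∀ ω ∈ S, ∀ a, |ω.cellEnergy (D a) R| ≤ C a) (P : ι → Prop) [DecidablePred P]
    (hP : ∀ a, P a → ∀ ω ∈ S, 0 ≤ ω.cellEnergy (D a) R) (θ θ' : ι → ℝ) :
    infCellEnergyOn S (viewFamily M₀ D θ) R - infCellEnergyOn S (viewFamily M₀ D θ') R ≤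
      ∑ a, C a * (if P a then max (θ a - θ' a) 0 else |θ a - θ' a|) := by
  rw [sub_le_iff_le_add]
  have key : infCellEnergyOn S (viewFamily M₀ D θ) R -
      ∑ a, C a * (if P a then max (θ a - θ' a) 0 else |θ a - θ' a|) ≤
      infCellEnergyOn S (viewFamily M₀ D θ') R := by
    refine le_infCellEnergyOn _ R hS fun ω hω => ?_
    rw [sub_le_iff_le_add]
    have h1 := infCellEnergyOn_le_cellEnergy (viewFamily M₀ D θ) R hω
    rw [ω.cellEnergy_viewFamily_eq_add_sum_sub_mul M₀ D θ θ' R] at h1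
    have h3 : ∑ a, (θ a - θ' a) * ω.cellEnergy (D a) R ≤
        ∑ a, C a * (if P a then max (θ a - θ' a) 0 else |θ a - θ' a|) :=
      Finset.sum_le_sum fun a _ => by
        have hCa : 0 ≤ C a := (abs_nonneg _).trans (hC ω hω a)
        by_cases hPa : P a
        · rw [if_pos hPa]
          have he := hP a hPa ω hω
          have heC : ω.cellEnergy (D a) R ≤ C a := (le_abs_self _).trans (hC ω hω a)
          rcases le_or_gt (θ a - θ' a) 0 with hδ | hδ
          · rw [max_eq_right hδ, mul_zero]
            exact mul_nonpos_of_nonpos_of_nonneg hδ he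
          · rw [max_eq_left hδ.le, mul_comm]
            exact mul_le_mul_of_nonneg_right heC hδ.le
        · rw [if_neg hPa]
          calc (θ a - θ' a) * ω.cellEnergy (D a) R ≤ |(θ a - θ' a) * ω.cellEnergy (D a) R| := le_abs_self _
            _ = |θ a - θ' a| * |ω.cellEnergy (D a) R| := abs_mul _ _
            _ ≤ |θ a - θ' a| * C a := mul_le_mul_of_nonneg_left (hC ω hω a) (abs_nonneg _)
            _ = C a * |θ a - θ' a| := mul_comm _ _
    linarith
  linarith

/-- **Floor transport, one-sided reading**: a floor `m ≤ e_S(θ₀)` at the ANCHOR `θ₀` gives at the TARGET `θ`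
`m − Σ_a C_a·δ_a ≤ e_S(θ)` with `δ_a = max (θ₀_a − θ_a) 0` on `P` (pay only if the target's positive coupling is
BELOW the anchor's) and `|θ₀_a − θ_a|` off `P`. [cite: Israel1979, Thm. I.3.4] -/
theorem le_infCellEnergyOn_viewFamily_of_anchor_oneSided (hS : S.Nonempty) {C : ι → ℝ}
    (hC : ∀ ω ∈ S, ∀ a, |ω.cellEnergy (D a) R| ≤ C a) (P : ι → Prop) [DecidablePred P]
    (hP : ∀ a, P a → ∀ ω ∈ S, 0 ≤ ω.cellEnergy (D a) R) {θ₀ : ι → ℝ} {m : ℝ}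
    (hm : m ≤ infCellEnergyOn S (viewFamily M₀ D θ₀) R) (θ : ι → ℝ) :
    m - ∑ a, C a * (if P a then max (θ₀ a - θ a) 0 else |θ₀ a - θ a|) ≤ infCellEnergyOn S (viewFamily M₀ D θ) R := by
  have h := infCellEnergyOn_viewFamily_sub_le_oneSided M₀ D R hS hC P hP θ₀ θ
  linarith

/-- **Cap transport, one-sided reading**: a cap `e_S(θ₀) ≤ c` at the anchor gives at the target
`e_S(θ) ≤ c + Σ_a C_a·δ_a` with `δ_a = max (θ_a − θ₀_a) 0` on `P` (pay only if the target's positive coupling is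
ABOVE the anchor's) and `|θ_a − θ₀_a|` off `P`. [cite: Israel1979, Thm. I.3.4] -/
theorem infCellEnergyOn_viewFamily_le_of_anchor_oneSided (hS : S.Nonempty) {C : ι → ℝ}
    (hC : ∀ ω ∈ S, ∀ a, |ω.cellEnergy (D a) R| ≤ C a) (P : ι → Prop) [DecidablePred P]
    (hP : ∀ a, P a → ∀ ω ∈ S, 0 ≤ ω.cellEnergy (D a) R) {θ₀ : ι → ℝ} {c : ℝ}
    (hc : infCellEnergyOn S (viewFamily M₀ D θ₀) R ≤ c) (θ : ι → ℝ) :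
    infCellEnergyOn S (viewFamily M₀ D θ) R ≤ c + ∑ a, C a * (if P a then max (θ a - θ₀ a) 0 else |θ a - θ₀ a|) := by
  have h := infCellEnergyOn_viewFamily_sub_le_oneSided M₀ D R hS hC P hP θ θ₀
  linarith

/-- **BOX ⇒ WORD WITH UPWARD EXTENSION**: a floor certified at the `2^|ι|` vertices of the coupling box `[lo, hi]`
holds at every coupling vector `θ ≥ lo` each of whose coordinates either stays `≤ hi_a` or moves along a direction
with non-negative conjugate density on `S` (then `lo_a ≤ hi_a` is all that is asked). Taking `hi_a = lo_a` in such
directions: only the `2^(|ι| − k)` vertices of the LOWER face in `k` one-sided directions are needed.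
[cite: Rockafellar1970, Thm 32.2] -/
theorem le_infCellEnergyOn_viewFamily_of_vertices_of_le [DecidableEq ι] (lo hi : ι → ℝ) {m : ℝ}
    (hm : ∀ v ∈ Fintype.piFinset (fun a => ({lo a, hi a} : Finset ℝ)), m ≤ infCellEnergyOn S (viewFamily M₀ D v) R)
    {θ : ι → ℝ} (hlo : lo ≤ θ)
    (hhi : ∀ a, θ a ≤ hi a ∨ (lo a ≤ hi a ∧ ∀ ω ∈ S, 0 ≤ ω.cellEnergy (D a) R)) :
    m ≤ infCellEnergyOn S (viewFamily M₀ D θ) R := by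
  set θ' : ι → ℝ := fun a => min (θ a) (hi a) with hθ'
  have hmem : θ' ∈ Set.Icc lo hi := by
    refine ⟨fun a => ?_, fun a => min_le_right _ _⟩
    rcases hhi a with h | h
    · exact le_min (hlo a) ((hlo a).trans h)
    · exact le_min (hlo a) h.1
  have hθ'le : θ' ≤ θ := fun a => min_le_left _ _
  have hbox := le_infCellEnergyOn_viewFamily_of_mem_Icc S M₀ D R lo hi hm hmem
  refine hbox.trans (infCellEnergyOn_viewFamily_mono M₀ D R hθ'le fun a ha => ?_)
  rcases hhi a with h | h
  · exact absurd (min_eq_left h) (ne_of_lt ha)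
  · exact h.2

end OneSided

/-! ### §2. The sign: on-site repulsions and site energies have non-negative conjugate densities -/

section Sign

variable {d : ℕ}

/-- **`0 ≤ Re ω(n_{xσ} n_{yτ})`** for every state: a product of two commuting occupation projections is a
projection. [cite: BratteliRobinsonI1987, §2.3.2] -/
theorem InfVolFermionState.re_expect_nAt_mul_nAt_nonneg (ω : InfVolFermionState d) {Λ : Finset (Site d)}
    {x y : Site d} (hx : x ∈ Λ) (hy : y ∈ Λ) (σ τ : Fin 2) :
    0 ≤ (ω.expect Λ (nAt x hx σ * nAt y hy τ)).re := by
  have hc : Commute (nAt x hx σ) (nAt y hy τ) := by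
    rw [nAt, nAt, ← numberAt_orb, ← numberAt_orb]
    exact numberAt_commute _ _
  have hP := isHermitian_isIdempotentElem_mul_of_commute hc
    (by rw [nAt, ← numberAt_orb]; exact numberAt_isHermitian _)
    (by rw [nAt, ← numberAt_orb]; exact numberAt_idempotent _)
    (by rw [nAt, ← numberAt_orb]; exact numberAt_isHermitian _)
    (by rw [nAt, ← numberAt_orb]; exact numberAt_idempotent _)
  exact ω.re_expect_nonneg_of_isHermitian_of_isIdempotentElem Λ hP.1 hP.2

/-- **`e_{sublatticeOnSite q c ε U}(ω) ≥ 0` for `ε, U ≥ 0`, every state** (`= [0 ∈ coset]·(ε ρ(ω) + U D(ω))` with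
`ρ(ω) ≥ 0`, `D(ω) ≥ 0`). [cite: BratteliRobinsonI1987, §2.3.2] -/
theorem InfVolFermionState.meanEnergy_sublatticeOnSite_nonneg (ω : InfVolFermionState d) (q : Fin d → ℕ)
    (c : Site d) {ε U : ℝ} (hε : 0 ≤ ε) (hU : 0 ≤ U) (R : ℝ) :
    0 ≤ ω.meanEnergy (sublatticeOnSite q c ε U) R := by
  rw [ω.meanEnergy_sublatticeOnSite q c ε U R]
  by_cases hc : InCoset q c 0
  · rw [if_pos hc]
    exact add_nonneg (mul_nonneg hε ω.density_nonneg)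
      (mul_nonneg hU (ω.re_expect_nAt_mul_nAt_nonneg (mem_singleton_self 0) (mem_singleton_self 0) 0 1))
  · rw [if_neg hc]

/-- **The views of a sublattice on-site pattern with `ε, U ≥ 0` have non-negative cell energy in EVERY state**
(no class restriction) — the sign hypothesis of §1 for such directions. [cite: BratteliRobinsonI1987, §2.3.2] -/
theorem InfVolFermionState.cellEnergy_sublatticeOnSiteViews_nonneg (q : Fin d → ℕ) (c : Site d) {ε U : ℝ}
    (hε : 0 ≤ ε) (hU : 0 ≤ U) (R : ℝ) (ω : InfVolFermionState d) :
    0 ≤ ω.cellEnergy (sublatticeOnSiteViews q c ε U) R := by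
  rw [InfVolFermionState.cellEnergy]
  exact mul_nonneg (inv_nonneg.2 (Nat.cast_nonneg _))
    (Finset.sum_nonneg fun n _ => (ω.shift (cellPos n)).meanEnergy_sublatticeOnSite_nonneg q _ hε hU R)

end Sign

/-! ### §3. The three-band (Emery) instance: `ε_d, ε_p, U_d, U_p` are one-sided -/

section Emery

/-- The physical parameter line, evaluated: `(t_pd, t_pp, ε_d, ε_p, U_d, U_p) ↦ θ`. [cite: PavariniEtAl2001, eq. (1)] -/
theorem emeryLine_apply (s : Fin 4 → ℝ) (p : Fin 6 → ℝ) :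
    emeryLine s p = ![p 0, p 0, p 0, p 0, s 0 * p 1, s 1 * p 1, s 2 * p 1, s 3 * p 1, p 2, p 3, p 3, p 4, p 5, p 5] :=
  rfl

/-- **The site-energy and repulsion directions (`8–13`: `ε_d`, `ε_{p_x}`, `ε_{p_y}`, `U_d`, `U_{p_x}`, `U_{p_y}`) of
the decorated `CuO₂` model have non-negative cell energy in every state.** [cite: BratteliRobinsonI1987, §2.3.2] -/
theorem cellEnergy_emeryDirections_nonneg (ω : InfVolFermionState 2) {a : Fin 14} (ha : 8 ≤ (a : ℕ)) :
    0 ≤ ω.cellEnergy (emeryDirections a) 1 := by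
  fin_cases a <;> norm_num at ha
  · simpa [emeryDirections] using
      InfVolFermionState.cellEnergy_sublatticeOnSiteViews_nonneg liebPeriods cuSite zero_le_one le_rfl 1 ω
  · simpa [emeryDirections] using
      InfVolFermionState.cellEnergy_sublatticeOnSiteViews_nonneg liebPeriods oxSite zero_le_one le_rfl 1 ω
  · simpa [emeryDirections] using
      InfVolFermionState.cellEnergy_sublatticeOnSiteViews_nonneg liebPeriods oySite zero_le_one le_rfl 1 ω
  · simpa [emeryDirections] using
      InfVolFermionState.cellEnergy_sublatticeOnSiteViews_nonneg liebPeriods cuSite le_rfl zero_le_one 1 ω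
  · simpa [emeryDirections] using
      InfVolFermionState.cellEnergy_sublatticeOnSiteViews_nonneg liebPeriods oxSite le_rfl zero_le_one 1 ω
  · simpa [emeryDirections] using
      InfVolFermionState.cellEnergy_sublatticeOnSiteViews_nonneg liebPeriods oySite le_rfl zero_le_one 1 ω

/-- **MONOTONICITY of the three-band energy density in `ε_d, ε_p, U_d, U_p`** (θ-level): if `θ ≤ θ'`
coordinatewise and the eight bond amplitudes (directions `0–7`) agree, then `e(θ, ρ) ≤ e(θ', ρ)` at every cell
filling `ρ`. [cite: Griffiths1966, §II] -/
theorem emeryEnergyDensity_mono (ρ : ℝ) {θ θ' : Fin 14 → ℝ} (hle : θ ≤ θ')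
    (hbond : ∀ a : Fin 14, (a : ℕ) < 8 → θ a = θ' a) :
    emeryEnergyDensity θ ρ ≤ emeryEnergyDensity θ' ρ := by
  refine infCellEnergyOn_viewFamily_mono _ _ 1 hle fun a ha ω _ => cellEnergy_emeryDirections_nonneg ω ?_
  by_contra h
  exact absurd (hbond a (by omega)) (ne_of_lt ha)

/-- **MONOTONICITY along the physical line**: at fixed `(t_pd, t_pp)` and any O–O sign pattern `s`, the three-band
energy density is non-decreasing in each of `ε_d, ε_p, U_d, U_p`. In box language: an energy FLOOR certified at
the lower `(ε_d, ε_p, U_d, U_p)` corner of a three-band box holds on the whole box (and above it); a CAP certified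
at the upper corner holds on the whole box (and below it). [cite: Griffiths1966, §II] -/
theorem emeryEnergyDensity_line_mono (s : Fin 4 → ℝ) (ρ : ℝ) {p p' : Fin 6 → ℝ} (h0 : p 0 = p' 0)
    (h1 : p 1 = p' 1) (h2 : p 2 ≤ p' 2) (h3 : p 3 ≤ p' 3) (h4 : p 4 ≤ p' 4) (h5 : p 5 ≤ p' 5) :
    emeryEnergyDensity (emeryLine s p) ρ ≤ emeryEnergyDensity (emeryLine s p') ρ := by
  refine emeryEnergyDensity_mono ρ ?_ ?_
  · intro a
    rw [emeryLine_apply, emeryLine_apply]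
    fin_cases a <;> simp [h0, h1, h2, h3, h4, h5]
  · intro a ha
    rw [emeryLine_apply, emeryLine_apply]
    fin_cases a <;> simp [h0, h1] <;> simp at ha

/-- **ONE-SIDED LIPSCHITZ bound for the three-band energy density** (realised filling): `e(θ, ρ) − e(θ', ρ) ≤
Σ_a C_a δ_a` with `δ_a = |θ_a − θ'_a|` on the eight bond classes (`C_a = 2`) and `δ_a = max (θ_a − θ'_a) 0` on the
site energies (`C_a = 2`) and repulsions (`C_a = 1`): lowering a site energy or a repulsion never raises the energy.
[cite: Israel1979, Thm. I.3.4] -/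
theorem emeryEnergyDensity_sub_le_oneSided {ρ : ℝ} (hne : (emeryStates ρ).Nonempty) (θ θ' : Fin 14 → ℝ) :
    emeryEnergyDensity θ ρ - emeryEnergyDensity θ' ρ ≤
      ∑ a, emeryConstants a * (if 8 ≤ (a : ℕ) then max (θ a - θ' a) 0 else |θ a - θ' a|) :=
  infCellEnergyOn_viewFamily_sub_le_oneSided _ _ 1 hne (fun ω _ a => abs_cellEnergy_emeryDirections_le ω a)
    (fun a : Fin 14 => 8 ≤ (a : ℕ)) (fun _ ha ω _ => cellEnergy_emeryDirections_nonneg ω ha) θ θ'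

/-- **BOX ⇒ WORD WITH UPWARD EXTENSION for the three-band model**: a floor certified at the vertices of a coupling
box `[lo, hi]` (`lo ≤ hi`) holds at every coupling vector `θ ≥ lo` whose eight bond amplitudes stay `≤ hi` — the
site energies and repulsions may exceed the box. With `hi_a = lo_a` on directions `8–13` the vertex set is the
`2⁸`-point lower face. [cite: Rockafellar1970, Thm 32.2] -/
theorem le_emeryEnergyDensity_of_vertices_of_le (ρ : ℝ) (lo hi : Fin 14 → ℝ) (hlohi : lo ≤ hi) {m : ℝ}
    (hm : ∀ v ∈ Fintype.piFinset (fun a => ({lo a, hi a} : Finset ℝ)), m ≤ emeryEnergyDensity v ρ)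
    {θ : Fin 14 → ℝ} (hlo : lo ≤ θ) (hhi : ∀ a : Fin 14, (a : ℕ) < 8 → θ a ≤ hi a) :
    m ≤ emeryEnergyDensity θ ρ := by
  refine le_infCellEnergyOn_viewFamily_of_vertices_of_le _ _ 1 lo hi hm hlo fun a => ?_
  by_cases ha : (a : ℕ) < 8
  · exact Or.inl (hhi a ha)
  · exact Or.inr ⟨hlohi a, fun ω _ => cellEnergy_emeryDirections_nonneg ω (by omega)⟩

end Emery

end Literature.MathematicalPhysics.QuantumLattice

end
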